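import Summits.QuantumFields.YangMills.Theorems.BalabanUVNodesN08AlphaEq324RowCumLetter
import Literature.MathematicalPhysics.QuantumFieldTheory.Balaban1983to89.B1Eq324BenfattoModelEq324

/-!
# Route «BalabanUVNodes», Track-A DAG node N08 = [Balaban1985UV3] Thm 1 p. 257 ∕ Thm 2 p. 272 — THE RE-LETTERED (3.24) ROW'S SHAPE INHABITED AT [2]'s MODEL
# (free-cumulant letter), at every constants record's RATE and at its BOOKED BUDGET once the record dominates [2]'s constant; and the TRANSPORT form of the
# row under a presentation of the step's fluctuation block as a push-forward

Cell `pub-ymgap`, seat `pub-ymgap-dag-n08-w4` gen 2 (INTENT-3; sequel of `…N08AlphaEq324RowCumLetter`).  `bears_on: R4∕N08`; filed `--supports stmt-QuantumFields-20542`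
(K1⁷).  THEOREMS ONLY (def-free, sorry-free, standard axioms); dag-n08-d's `B1Eq324BenfattoModelEq324.eq324_benfatto_model` (p592669 ✓, over the tree theorem
`…Sect5BasicLemma.basicLemmaPrinted_holds` p591044 ✓ = the Basic Lemma of [BenfattoEtAl1978] p. 152) and gen 0's `…RowSocket.eq324_mono` consumed BY NAME.

WHY (A6 for the re-lettered clause `…RowCumLetter.StepAlphaEq324CoreLTAt … c`).  At the lane's χ-weighted letter `c := (𝔖 ·).cum` that clause IS the landed one
(`…RowCumLetter.coreLTAt_cum_iff`), hence inhabited exactly when that one is (gen 0's zero-data witnesses `…RowRangeZero`).  This file shows that its (3.24) row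
`h324 : ∀ h U, Eq324 (∫ ω in box h, e^{𝒱 h U ω} ∂μ) (c h U) n̄ (Ca + Cc) (Lᵏg₀²) (3+κ₀) |T₁^{(k)}|` is, at the FREE letter, the shape of a GENUINE INTERACTING GAUSSIAN
MODEL's theorem — the one print cites ([Balaban1982Higgs1] p. 616 → [BenfattoEtAl1978] p. 152): with `Fl := (ℤ³ → ℝ)`, `μ := P̂₀ = P0 3 α β` (the nearest-neighbour
free field (1.1)), `box := smallFieldSet I (p(η))` (the product of the characteristic functions `χ̂_Δ`, threshold `p(η) = b₀(1 + log η⁻¹)^{p₀}`), `𝒱 := H_J =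
hamiltonian s D ϰ a J` (the polynomials (4.5) with coefficients `≤ c₀·η^σ`) and the FREE letter `c n := ℰ̂₀ᵀ(H_J; n) = truncatedExp (P0 3 α β) (hamiltonian …) n`:
* §1 ★ `eq324RowShape_benfatto_model` — for every constants record `𝔠` (truncation `n̄ = 𝔠.nbar`, rate `3 + κ₀`, `κ₀ < ½`) and every coupling power `σ` with
  `3 + κ₀ < σ(n̄ + 1)`: `∃ η₀ ∈ (0,1], C ≥ 0, ∀ η ∈ (0, η₀], ∀ s, I ⊇ J ≠ ∅, a` with `coefSup ≤ c₀η^σ`: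
  `Eq324 (∫ z in smallFieldSet I (p η), e^{H_J z} ∂P̂₀) (n ↦ ℰ̂₀ᵀ(H_J; n)) 𝔠.nbar C η (3 + 𝔠.κ₀) |I|` — `eq324_benfatto_model` at `t := n̄`, `κ := 3 + κ₀` and
  `∫ Πχ̂ e^{H} dP̂₀ = ∫_{smallFieldSet} e^{H} dP̂₀` (`cutoffBoltzmann` is the indicator-weighted Boltzmann factor); `eq324RowShape_benfatto_model_half` — print's
  coupling power `σ = ½` (coefficients `O(g) = O(η^{1∕2})`) whenever `5 + 2κ₀ < n̄` (so `n̄ = 6`, «up to the sixth order», suffices for every `κ₀ < ½`).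
* §2 ★ `eq324RowShape_benfatto_model_booked` — AT THE RECORD'S BOOKED BUDGET: the same `η₀, C`, and for every lattice approximation `S` and step `k` with
  `Lᵏ·g₀² ≤ η₀`, every record with `C ≤ Ca + Cc`, every `I` with `|I| ≤ |T₁^{(k)}|`:
  `Eq324 (∫ z in smallFieldSet I (p(Lᵏg₀²)), e^{H_J z} ∂P̂₀) (n ↦ ℰ̂₀ᵀ(H_J; n)) 𝔠.nbar (𝔠.Ca + 𝔠.Cc) (Lᵏ·S.g0sq) (3 + 𝔠.κ₀) (S.sites k)` — LITERALLY the right-hand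
  currencies of the row `StepAlphaEq324CoreLTAt.h324` (bound weakening `eq324_mono`).
* §3 `setIntegral_exp_map_eq` + ★ `h324RowAt_of_map` (+ `cumulantOf_moments_map_eq`, ★ `h324RowAt_freeLetter_of_map`, `truncatedExp_eq_cumulantOf`) — TRANSPORT: if the step's fluctuation block is PRESENTED as a push-forward, `(𝔖 k).μ = ν.map Φ` with `Φ`
  measurable, boxes measurable and potentials measurable, then the row at `𝔖` (any letter `c`) follows from the `Eq324` statements about
  `∫ z in Φ⁻¹'(box h), e^{𝒱 h U (Φ z)} ∂ν` — the form in which a class-model theorem (§1–§2 at [2]'s model; the n08-b∕-c∕-d class editions to come) is consumed.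
HONEST SCOPE.  §1–§2 inhabit the row's SHAPE at the cited model and show the record's currencies `(n̄, Ca + Cc, Lᵏg₀², 3 + κ₀, |T₁^{(k)}|)` are COMPATIBLE with [2]'s
conclusion (`κ₀ < ½` is exactly what `n̄ = 6`, `σ = ½` affords); they do NOT produce B10's step data: the IDENTIFICATION of `dμ_{C^{(k)}}(Ω_{k+1}, U_{k+1})`, its box and
`𝒱_k` with a (class) model — the `Φ`, `ν` of §3 with `Φ⁻¹'(box h)` a small-field set and `𝒱 h U ∘ Φ` a Hamiltonian of the class — is the cluster-expansion-class
statement neither paper displays (class II) and is untouched.  Count-neutral; N08 NOT discharged; one finite 𝕋⁴ programme at fixed ε, d = 3 tori inside the record,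
Bałaban AS PRINTED; nothing continuum ∕ ℝ⁴ ∕ OS ∕ mass gap ∕ Clay — R4 closes the conditional finite-𝕋⁴ rung `BalabanLadder.UV` only.

References: [Balaban1985UV3] T. Bałaban, CMP 102 (1985) 255–275 — (24) p. 262, (58) p. 270, p. 261 «up to the sixth order»; [Balaban1982Higgs1] T. Bałaban,
CMP 85 (1982) 603–636 — (3.24) p. 616 «e.g. n > 6»; [BenfattoEtAl1978] G. Benfatto et al., CMP 59 (1978) 143–166 — (1.1) p. 144, (4.5)–(4.7) p. 152, Remark 1.
-/

noncomputable section

namespace Summit.QuantumFields.YangMills.Theorems.BalabanUVNodesN08AlphaEq324RowCumLetterModel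

open MeasureTheory
open scoped BigOperators Nat
open Literature.MathematicalPhysics.QuantumFieldTheory.Balaban1983to89
open Literature.MathematicalPhysics.QuantumFieldTheory.Balaban1983to89.B1Sect3Statements (Eq324)
open Literature.MathematicalPhysics.QuantumFieldTheory.Balaban1983to89.B1Eq324BenfattoLemma
  (freeCov P0 Coef hamiltonian coefSup smallFieldSet cutoffBoltzmann truncatedExp measurableSet_smallFieldSet)
open Literature.MathematicalPhysics.QuantumFieldTheory.Balaban1983to89.B1Eq324BenfattoModelEq324 (eq324_benfatto_model)
open Literature.MathematicalPhysics.QuantumFieldTheory.Balaban1985CMP102.Setting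
open Summit.QuantumFields.Balaban3D.Carriers
open Summit.QuantumFields.Balaban3D.Proofs.ScalesArithmetic (g0sq_pos L_pos sites_nonneg)
open Summit.QuantumFields.Balaban3D.Proofs.Primitives (AlphaConsts)
open Summit.QuantumFields.Balaban3D.Proofs.GroupModelLieC (lieC)
open Summit.QuantumFields.YangMills.Theorems.BalabanUVNodesN08AlphaEq324RowSocket (eq324_mono)
open Literature.Probability.LatticeModels (cumulantOf)

variable {L : ℕ}

/-! ## §1 The re-lettered (3.24) row's shape at [2]'s model, at every record's truncation order and rate -/

section Model

variable {N : ℕ} (𝔠 : AlphaConsts L N) {α β : ℝ}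

/-- The cut-off Boltzmann integral of [2] is the lane's «box fluctuation integral» shape: `∫ Π_Δχ̂_Δ e^{H} dP̂₀ = ∫_{smallFieldSet I b} e^{H} dP̂₀`.
[cite: BenfattoEtAl1978, (4.6)–(4.7) p.152] -/
theorem integral_cutoffBoltzmann_eq_setIntegral (μ : Measure ((Fin 3 → ℤ) → ℝ)) (H : ((Fin 3 → ℤ) → ℝ) → ℝ) (I : Finset (Fin 3 → ℤ)) (b : ℝ) :
    ∫ z, cutoffBoltzmann H I b z ∂μ = ∫ z in smallFieldSet I b, Real.exp (H z) ∂μ := by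
  simp only [cutoffBoltzmann]
  exact integral_indicator (measurableSet_smallFieldSet I b)

/-- ★ **THE RE-LETTERED (3.24) ROW'S SHAPE IS A THEOREM AT [2]'s MODEL, at every constants record's truncation order `n̄` and rate `3 + κ₀`.**  For the free
field `P̂₀ = P0 3 α β` (`α, β > 0`, `E z_Δ² ≤ ½`), thresholds `p(η) = b₀(1 + log η⁻¹)^{p₀}` (`b₀ > 0`, `p₀ > 2∕3`), polynomials `H_J` of (4.5) (`D`, `ϰ > 0`) with
coefficients `≤ c₀·η^σ`, and any coupling power `σ > 0` with `3 + κ₀ < σ(n̄ + 1)`: there are `η₀ ∈ (0, 1]`, `C ≥ 0` with, for all `η ∈ (0, η₀]`, `s`, `I ⊇ J`, `I ≠ ∅`, `a`,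
`Eq324 (∫ z in smallFieldSet I (p η), e^{H_J z} ∂P̂₀) (n ↦ ℰ̂₀ᵀ(H_J; n)) n̄ C η (3 + κ₀) |I|` — the box integral of the model, the FREE truncated expectations as the
cumulant letter, the record's `n̄` and rate.  (`eq324_benfatto_model` at `t := n̄`, `κ := 3 + κ₀`.)
[cite: BenfattoEtAl1978, Lemma (4.5)–(4.7) p.152, Remark 1; Balaban1982Higgs1, (3.24) p.616; Balaban1985UV3, (58) p.270] -/
theorem eq324RowShape_benfatto_model (hα : 0 < α) (hβ : 0 < β) (hvar : freeCov 3 α β 0 0 ≤ 1 / 2)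
    (D : ℕ) {ϰ : ℝ} (hϰ : 0 < ϰ) {b₀ p₀ σ c₀ : ℝ} (hb₀ : 0 < b₀) (hp₀ : 2 / 3 < p₀) (hσ : 0 < σ) (hc₀ : 0 ≤ c₀)
    (hκσ : 3 + 𝔠.κ₀ < σ * (𝔠.nbar + 1)) :
    ∃ η₀ C : ℝ, 0 < η₀ ∧ η₀ ≤ 1 ∧ 0 ≤ C ∧ ∀ η : ℝ, 0 < η → η ≤ η₀ →
      ∀ (s : ℕ) (I J : Finset (Fin 3 → ℤ)) (a : Coef 3), I.Nonempty → J ⊆ I → coefSup s D a J ≤ c₀ * η ^ σ →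
        Eq324 (∫ z in smallFieldSet I (B10.pFun b₀ p₀ η), Real.exp (hamiltonian s D ϰ a J z) ∂P0 3 α β)
          (fun n => truncatedExp (P0 3 α β) (hamiltonian s D ϰ a J) n) 𝔠.nbar C η (3 + 𝔠.κ₀) I.card := by
  obtain ⟨η₀, C, hη₀, hη₀1, hC, h⟩ := eq324_benfatto_model (d := 3) (by norm_num) hα hβ hvar 𝔠.nbar D hϰ hb₀ hp₀ hσ hc₀
    (κ := 3 + 𝔠.κ₀) (by linarith [𝔠.κ₀_pos]) hκσ
  refine ⟨η₀, C, hη₀, hη₀1, hC, fun η hη hηle s I J a hI hJI hA => ?_⟩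
  have h' := h η hη hηle s I J a hI hJI hA
  rwa [integral_cutoffBoltzmann_eq_setIntegral] at h'

/-- **… AT PRINT's COUPLING POWER `σ = ½`** (coefficients `O(g_k) = O(η^{1∕2})`, [Balaban1985UV3] (56)–(57)): available for every record with `5 + 2κ₀ < n̄` — so the
printed «up to the sixth order» `n̄ = 6` serves EVERY `κ₀ < ½` ([Balaban1982Higgs1] «e.g. n > 6», «κ > d»).
[cite: BenfattoEtAl1978, Lemma p.152; Balaban1982Higgs1, (3.24) p.616; Balaban1985UV3, p.261 + (58) p.270] -/
theorem eq324RowShape_benfatto_model_half (hα : 0 < α) (hβ : 0 < β) (hvar : freeCov 3 α β 0 0 ≤ 1 / 2)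
    (D : ℕ) {ϰ : ℝ} (hϰ : 0 < ϰ) {b₀ p₀ c₀ : ℝ} (hb₀ : 0 < b₀) (hp₀ : 2 / 3 < p₀) (hc₀ : 0 ≤ c₀) (hn : 5 + 2 * 𝔠.κ₀ < 𝔠.nbar) :
    ∃ η₀ C : ℝ, 0 < η₀ ∧ η₀ ≤ 1 ∧ 0 ≤ C ∧ ∀ η : ℝ, 0 < η → η ≤ η₀ →
      ∀ (s : ℕ) (I J : Finset (Fin 3 → ℤ)) (a : Coef 3), I.Nonempty → J ⊆ I → coefSup s D a J ≤ c₀ * η ^ (1 / 2 : ℝ) →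
        Eq324 (∫ z in smallFieldSet I (B10.pFun b₀ p₀ η), Real.exp (hamiltonian s D ϰ a J z) ∂P0 3 α β)
          (fun n => truncatedExp (P0 3 α β) (hamiltonian s D ϰ a J) n) 𝔠.nbar C η (3 + 𝔠.κ₀) I.card :=
  eq324RowShape_benfatto_model 𝔠 hα hβ hvar D hϰ hb₀ hp₀ (by norm_num) hc₀ (by linarith)

/-- **`n̄ = 6` suffices at `σ = ½` for every record** (`κ₀ < ½` ⇒ `5 + 2κ₀ < 6`). [cite: Balaban1985UV3, p.261 «up to the sixth order»] -/
theorem five_add_two_mul_κ₀_lt_six : 5 + 2 * 𝔠.κ₀ < 6 := by linarith [𝔠.κ₀_lt_half]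

end Model

/-! ## §2 … and at the record's BOOKED budget `(Ca + Cc)·(Lᵏ·g₀²)^{3+κ₀}·|T₁^{(k)}|` -/

section Booked

variable {N : ℕ} (𝔠 : AlphaConsts L N) {α β : ℝ}

/-- Budget comparison: `C·η^κ·|I| ≤ (Ca + Cc)·η^κ·|T₁^{(k)}|` when `C ≤ Ca + Cc`, `|I| ≤ |T₁^{(k)}|`, `η > 0`. [cite: Balaban1985UV3, (58) p.270 (bookkeeping)] -/
theorem budget_le {C C' η κ v v' : ℝ} (hC : 0 ≤ C) (hCC' : C ≤ C') (hη : 0 < η) (hv : 0 ≤ v) (hvv' : v ≤ v') :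
    C * η ^ κ * v ≤ C' * η ^ κ * v' := by
  have hηκ : 0 ≤ η ^ κ := Real.rpow_nonneg hη.le κ
  calc C * η ^ κ * v ≤ C' * η ^ κ * v := mul_le_mul_of_nonneg_right (mul_le_mul_of_nonneg_right hCC' hηκ) hv
    _ ≤ C' * η ^ κ * v' := mul_le_mul_of_nonneg_left hvv' (mul_nonneg (hC.trans hCC') hηκ)

/-- ★ **THE RE-LETTERED (3.24) ROW'S SHAPE AT THE RECORD'S BOOKED BUDGET, INHABITED BY [2]'s MODEL.**  With `η₀, C` of `eq324RowShape_benfatto_model`: for every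
lattice approximation `S` and step `k` deep enough in the ultraviolet (`Lᵏ·g₀² ≤ η₀`), every record whose booked constant dominates [2]'s (`C ≤ Ca + Cc`), and every
region with `|I| ≤ |T₁^{(k)}|`:
`Eq324 (∫ z in smallFieldSet I (p(Lᵏg₀²)), e^{H_J z} ∂P̂₀) (n ↦ ℰ̂₀ᵀ(H_J; n)) 𝔠.nbar (𝔠.Ca + 𝔠.Cc) (Lᵏ·S.g0sq) (3 + 𝔠.κ₀) (S.sites k)` — literally the right-hand
currencies of `…RowCumLetter.StepAlphaEq324CoreLTAt.h324` (the cumulant letter being the free one).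
[cite: Balaban1985UV3, (58) p.270; Balaban1982Higgs1, (3.24) p.616; BenfattoEtAl1978, Lemma p.152] -/
theorem eq324RowShape_benfatto_model_booked (hα : 0 < α) (hβ : 0 < β) (hvar : freeCov 3 α β 0 0 ≤ 1 / 2)
    (D : ℕ) {ϰ : ℝ} (hϰ : 0 < ϰ) {b₀ p₀ σ c₀ : ℝ} (hb₀ : 0 < b₀) (hp₀ : 2 / 3 < p₀) (hσ : 0 < σ) (hc₀ : 0 ≤ c₀)
    (hκσ : 3 + 𝔠.κ₀ < σ * (𝔠.nbar + 1)) :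
    ∃ η₀ C : ℝ, 0 < η₀ ∧ η₀ ≤ 1 ∧ 0 ≤ C ∧ ∀ (S : Scales L) (k : ℕ), (L : ℝ) ^ k * S.g0sq ≤ η₀ → C ≤ 𝔠.Ca + 𝔠.Cc →
      ∀ (s : ℕ) (I J : Finset (Fin 3 → ℤ)) (a : Coef 3), I.Nonempty → J ⊆ I →
        coefSup s D a J ≤ c₀ * ((L : ℝ) ^ k * S.g0sq) ^ σ → (I.card : ℝ) ≤ S.sites k →
        Eq324 (∫ z in smallFieldSet I (B10.pFun b₀ p₀ ((L : ℝ) ^ k * S.g0sq)), Real.exp (hamiltonian s D ϰ a J z) ∂P0 3 α β)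
          (fun n => truncatedExp (P0 3 α β) (hamiltonian s D ϰ a J) n) 𝔠.nbar (𝔠.Ca + 𝔠.Cc) ((L : ℝ) ^ k * S.g0sq) (3 + 𝔠.κ₀)
          (S.sites k) := by
  obtain ⟨η₀, C, hη₀, hη₀1, hC, h⟩ := eq324RowShape_benfatto_model 𝔠 hα hβ hvar D hϰ hb₀ hp₀ hσ hc₀ hκσ
  refine ⟨η₀, C, hη₀, hη₀1, hC, fun S k hηle hCC s I J a hI hJI hA hI' => ?_⟩
  have hη : 0 < (L : ℝ) ^ k * S.g0sq := mul_pos (pow_pos (L_pos S) k) (g0sq_pos S)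
  exact eq324_mono (h _ hη hηle s I J a hI hJI hA) (budget_le hC hCC hη (Nat.cast_nonneg _) hI')

end Booked

/-! ## §3 Transport: the row under a presentation of the step's fluctuation block as a push-forward -/

section Transport

/-- `∫_{box} e^{V} d(ν∘Φ⁻¹) = ∫_{Φ⁻¹' box} e^{V ∘ Φ} dν` (change of variables for the box fluctuation integral). [folklore; cite: Balaban1985UV3, (58) p.270 (bookkeeping)] -/
theorem setIntegral_exp_map_eq {Ω' Fl : Type*} [MeasurableSpace Ω'] [MeasurableSpace Fl] (ν : Measure Ω') {Φ : Ω' → Fl} (hΦ : Measurable Φ)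
    {box : Set Fl} (hbox : MeasurableSet box) {V : Fl → ℝ} (hV : Measurable V) :
    ∫ ω in box, Real.exp (V ω) ∂(ν.map Φ) = ∫ z in Φ ⁻¹' box, Real.exp (V (Φ z)) ∂ν :=
  setIntegral_map hbox (Real.measurable_exp.comp hV).aestronglyMeasurable hΦ.aemeasurable

variable {S : Scales L} {G : Type} [GaugeGroup G] [MeasurableSpace G] [HaarData G] (𝔊 : GroupModel G) (𝔠 : AlphaConsts L 𝔊.N)
  (𝔖 : ∀ k, StepSeries S G ↥(lieC 𝔊) (nblkOf S 𝔠.lane.carrier k) k) (k : ℕ)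
  (c : Hist S.P (k + 1) → GaugeField S.P (k + 1) G → ℕ → ℝ)

/-- ★ **THE RE-LETTERED (3.24) ROW UNDER A PRESENTATION OF THE STEP's FLUCTUATION BLOCK**: if `(𝔖 k).μ = ν.map Φ` (`Φ : Ω' → Fl` measurable), the boxes are
measurable and the potentials measurable, then the row at `𝔖` (any cumulant letter `c`, any constants `C₂, s, κ, vol`) follows from the `Eq324` statements about the
pulled-back integrals `∫ z in Φ⁻¹'(box h), e^{𝒱 h U (Φ z)} ∂ν` — the form in which a model∕class theorem like §1–§2 is consumed once B10's step data are so presented.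
[cite: Balaban1985UV3, (58) p.270; Balaban1982Higgs1, (3.24) p.616] -/
theorem h324RowAt_of_map {Ω' : Type*} [MeasurableSpace Ω'] (ν : Measure Ω') {Φ : Ω' → (𝔖 k).Fl} (hΦ : Measurable Φ)
    (hμ : (𝔖 k).μ = ν.map Φ) (hboxm : ∀ h, MeasurableSet ((𝔖 k).box h)) (hVm : ∀ h U, Measurable ((𝔖 k).𝒱 h U)) {C₂ s κ vol : ℝ}
    (h324' : ∀ h (U : GaugeField S.P (k + 1) G),
      Eq324 (∫ z in Φ ⁻¹' ((𝔖 k).box h), Real.exp ((𝔖 k).𝒱 h U (Φ z)) ∂ν) (c h U) 𝔠.nbar C₂ s κ vol) :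
    ∀ h (U : GaugeField S.P (k + 1) G), Eq324 (∫ ω in (𝔖 k).box h, Real.exp ((𝔖 k).𝒱 h U ω) ∂(𝔖 k).μ) (c h U) 𝔠.nbar C₂ s κ vol := by
  intro h U
  rw [hμ, setIntegral_exp_map_eq ν hΦ (hboxm h) (hVm h U)]
  exact h324' h U

/-- **Transport of the FREE moment-cumulant letter**: the moment sequence of `V` under `ν∘Φ⁻¹` is that of `V ∘ Φ` under `ν`, so the free cumulants
`cumulantOf (m ↦ ∫ Vᵐ d(ν∘Φ⁻¹))` (the letter of [BenfattoEtAl1978] (2.7) ∕ `B1Eq324BenfattoLemma.truncatedExp`, written for an arbitrary sample space) are those of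
`V ∘ Φ` under `ν`. [cite: BenfattoEtAl1978, (2.7) p.147 (bookkeeping)] -/
theorem cumulantOf_moments_map_eq {Ω' Fl : Type*} [MeasurableSpace Ω'] [MeasurableSpace Fl] (ν : Measure Ω') {Φ : Ω' → Fl} (hΦ : Measurable Φ)
    {V : Fl → ℝ} (hV : Measurable V) (n : ℕ) :
    cumulantOf (fun m => ∫ ω, V ω ^ m ∂(ν.map Φ)) n = cumulantOf (fun m => ∫ z, V (Φ z) ^ m ∂ν) n := by
  congr 1
  funext m
  exact integral_map hΦ.aemeasurable (hV.pow_const m).aestronglyMeasurable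

/-- ★ **THE (3.24) ROW AT THE FREE MOMENT-CUMULANT LETTER UNDER A PRESENTATION**: with the step's free letter `c h U n := cumulantOf (m ↦ ∫ (𝒱 h U)ᵐ dμ) n`
(the [2]-letter (2.7) at B10's data — no cut-off in the cumulants) and `(𝔖 k).μ = ν.map Φ`, the row follows from the `Eq324` statements about `ν`, the
pulled-back boxes `Φ⁻¹'(box h)`, potentials `𝒱 h U ∘ Φ` AND their free cumulants under `ν` — exactly the shape of §1–§2 (`truncatedExp ν H n = cumulantOf (m ↦
∫ Hᵐ dν) n`) and of the class editions to come.  (Inhabited at `Φ := id`; whether B10's `dμ_{C^{(k)}}` admits a presentation by a model of the [2]-class with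
small-field preimages and (4.5)-type pulled-back potentials is the class II identification — gen 0's `N08-IDENT-BRIDGE-NOTE.md` §2: NOT by the literal `P̂₀` of
[2].) [cite: Balaban1985UV3, (58) p.270; Balaban1982Higgs1, (3.24) p.616; BenfattoEtAl1978, (2.7) p.147 + Lemma p.152] -/
theorem h324RowAt_freeLetter_of_map {Ω' : Type*} [MeasurableSpace Ω'] (ν : Measure Ω') {Φ : Ω' → (𝔖 k).Fl} (hΦ : Measurable Φ)
    (hμ : (𝔖 k).μ = ν.map Φ) (hboxm : ∀ h, MeasurableSet ((𝔖 k).box h)) (hVm : ∀ h U, Measurable ((𝔖 k).𝒱 h U)) {C₂ s κ vol : ℝ}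
    (h324' : ∀ h (U : GaugeField S.P (k + 1) G),
      Eq324 (∫ z in Φ ⁻¹' ((𝔖 k).box h), Real.exp ((𝔖 k).𝒱 h U (Φ z)) ∂ν)
        (fun n => cumulantOf (fun m => ∫ z, (𝔖 k).𝒱 h U (Φ z) ^ m ∂ν) n) 𝔠.nbar C₂ s κ vol) :
    ∀ h (U : GaugeField S.P (k + 1) G), Eq324 (∫ ω in (𝔖 k).box h, Real.exp ((𝔖 k).𝒱 h U ω) ∂(𝔖 k).μ)
      (fun n => cumulantOf (fun m => ∫ ω, (𝔖 k).𝒱 h U ω ^ m ∂(𝔖 k).μ) n) 𝔠.nbar C₂ s κ vol := by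
  intro h U
  rw [hμ, setIntegral_exp_map_eq ν hΦ (hboxm h) (hVm h U)]
  have hc : (fun n => cumulantOf (fun m => ∫ ω, (𝔖 k).𝒱 h U ω ^ m ∂(ν.map Φ)) n) =
      fun n => cumulantOf (fun m => ∫ z, (𝔖 k).𝒱 h U (Φ z) ^ m ∂ν) n := funext fun n => cumulantOf_moments_map_eq ν hΦ (hVm h U) n
  rw [hc]
  exact h324' h U

/-- The [2]-letter IS the free moment-cumulant letter: `truncatedExp μ H n = cumulantOf (m ↦ ∫ Hᵐ dμ) n` (definitional). [cite: BenfattoEtAl1978, (2.7) p.147] -/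
theorem truncatedExp_eq_cumulantOf (μ : Measure ((Fin 3 → ℤ) → ℝ)) (H : ((Fin 3 → ℤ) → ℝ) → ℝ) (n : ℕ) :
    truncatedExp μ H n = cumulantOf (fun m => ∫ z, H z ^ m ∂μ) n := rfl

end Transport

/-! ## §4 (v1.1) … at [B10]'s OWN currencies: small parameter `η := g_k` (the running coupling), threshold `p(g_k)`, coefficients `O(g_k^σ)`

§2 instantiates [2]'s small parameter at `η := Lᵏg₀² = g_k²`, which puts the model's small-field threshold at `p(g_k²)`.  Print's (41)∕(58) restrict the
fluctuation field by `p(g_k) = b₀(1 + log g_k⁻¹)^{p₀}` — the SAME function `B10.pFun b₀ p₀ (S.gk k)` the lane reads in `bound28` ∕ `hLF67` — and (56)–(57) give the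
effective potential coefficients `O(g_k)`.  Reading [2]'s `η` as `g_k` itself (coupling power `σ`, rate `κ := 6 + 2κ₀ < σ(n̄ + 1)`) lands EXACTLY there, and the error
`C·g_k^{6+2κ₀}·|I|` IS the row's unit `C·(Lᵏg₀²)^{3+κ₀}·|I|` (`g_k² = Lᵏg₀²`, `ScalesArithmetic.norm_scale_eq`). -/

section Coupling

open Summit.QuantumFields.Balaban3D.Proofs.ScalesArithmetic (gk_pos norm_scale_eq)

variable {N : ℕ} (𝔠 : AlphaConsts L N) {α β : ℝ}

/-- `g_k^{6+2κ₀} = (Lᵏ·g₀²)^{3+κ₀}` (`g_k² = Lᵏg₀²`). [cite: Balaban1985UV3, (41) p.266 + (58) p.270 (bookkeeping)] -/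
theorem gk_rpow_six_add (S : Scales L) (κ₀ : ℝ) (k : ℕ) : S.gk k ^ (6 + 2 * κ₀) = ((L : ℝ) ^ k * S.g0sq) ^ (3 + κ₀) := by
  rw [norm_scale_eq, show (6 : ℝ) + 2 * κ₀ = (2 : ℕ) * (3 + κ₀) by push_cast; ring, Real.rpow_natCast_mul (gk_pos S k).le]

/-- ★ **THE RE-LETTERED (3.24) ROW'S SHAPE AT THE RECORD'S BOOKED BUDGET, INHABITED BY [2]'s MODEL AT [B10]'s OWN CURRENCIES**: small parameter `η := g_k`, small-field
threshold `p(g_k) = B10.pFun b₀ p₀ (S.gk k)` (print's (41)∕(58)), coefficients `≤ c₀·g_k^σ` with `6 + 2κ₀ < σ(n̄ + 1)`.  With `η₀, C` depending on the model, `n̄`, `κ₀`, `σ`: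
for every lattice approximation `S` and step `k` with `g_k ≤ η₀`, every record with `C ≤ Ca + Cc`, every `I ⊇ J ≠ ∅` with `|I| ≤ |T₁^{(k)}|`:
`Eq324 (∫ z in smallFieldSet I (p(g_k)), e^{H_J z} ∂P̂₀) (n ↦ ℰ̂₀ᵀ(H_J; n)) 𝔠.nbar (𝔠.Ca + 𝔠.Cc) (Lᵏ·S.g0sq) (3 + 𝔠.κ₀) (S.sites k)`.
[cite: Balaban1985UV3, (41) p.266 + (56)–(58) p.270; Balaban1982Higgs1, (3.24) p.616; BenfattoEtAl1978, Lemma p.152] -/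
theorem eq324RowShape_benfatto_model_gk (hα : 0 < α) (hβ : 0 < β) (hvar : freeCov 3 α β 0 0 ≤ 1 / 2)
    (D : ℕ) {ϰ : ℝ} (hϰ : 0 < ϰ) {b₀ p₀ σ c₀ : ℝ} (hb₀ : 0 < b₀) (hp₀ : 2 / 3 < p₀) (hσ : 0 < σ) (hc₀ : 0 ≤ c₀)
    (hκσ : 6 + 2 * 𝔠.κ₀ < σ * (𝔠.nbar + 1)) :
    ∃ η₀ C : ℝ, 0 < η₀ ∧ η₀ ≤ 1 ∧ 0 ≤ C ∧ ∀ (S : Scales L) (k : ℕ), S.gk k ≤ η₀ → C ≤ 𝔠.Ca + 𝔠.Cc →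
      ∀ (s : ℕ) (I J : Finset (Fin 3 → ℤ)) (a : Coef 3), I.Nonempty → J ⊆ I →
        coefSup s D a J ≤ c₀ * S.gk k ^ σ → (I.card : ℝ) ≤ S.sites k →
        Eq324 (∫ z in smallFieldSet I (B10.pFun b₀ p₀ (S.gk k)), Real.exp (hamiltonian s D ϰ a J z) ∂P0 3 α β)
          (fun n => truncatedExp (P0 3 α β) (hamiltonian s D ϰ a J) n) 𝔠.nbar (𝔠.Ca + 𝔠.Cc) ((L : ℝ) ^ k * S.g0sq) (3 + 𝔠.κ₀)
          (S.sites k) := by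
  obtain ⟨η₀, C, hη₀, hη₀1, hC, h⟩ := eq324_benfatto_model (d := 3) (by norm_num) hα hβ hvar 𝔠.nbar D hϰ hb₀ hp₀ hσ hc₀
    (κ := 6 + 2 * 𝔠.κ₀) (by linarith [𝔠.κ₀_pos]) hκσ
  refine ⟨η₀, C, hη₀, hη₀1, hC, fun S k hgk hCC s I J a hI hJI hA hI' => ?_⟩
  have hg : 0 < S.gk k := gk_pos S k
  have h' := h _ hg hgk s I J a hI hJI hA
  rw [integral_cutoffBoltzmann_eq_setIntegral] at h'
  refine eq324_mono h' ?_
  rw [gk_rpow_six_add]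
  exact budget_le hC hCC (mul_pos (pow_pos (L_pos S) k) (g0sq_pos S)) (Nat.cast_nonneg _) hI'

/-- **… AT PRINT's COUPLING POWER `σ = 1`** (effective potential coefficients `O(g_k)`, (56)–(57)): available whenever `5 + 2κ₀ < n̄` — `n̄ = 6` for every record
(`five_add_two_mul_κ₀_lt_six`). [cite: Balaban1985UV3, (56)–(58) p.270 + p.261 «up to the sixth order»; BenfattoEtAl1978, Lemma p.152] -/
theorem eq324RowShape_benfatto_model_gk_one (hα : 0 < α) (hβ : 0 < β) (hvar : freeCov 3 α β 0 0 ≤ 1 / 2)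
    (D : ℕ) {ϰ : ℝ} (hϰ : 0 < ϰ) {b₀ p₀ c₀ : ℝ} (hb₀ : 0 < b₀) (hp₀ : 2 / 3 < p₀) (hc₀ : 0 ≤ c₀) (hn : 5 + 2 * 𝔠.κ₀ < 𝔠.nbar) :
    ∃ η₀ C : ℝ, 0 < η₀ ∧ η₀ ≤ 1 ∧ 0 ≤ C ∧ ∀ (S : Scales L) (k : ℕ), S.gk k ≤ η₀ → C ≤ 𝔠.Ca + 𝔠.Cc →
      ∀ (s : ℕ) (I J : Finset (Fin 3 → ℤ)) (a : Coef 3), I.Nonempty → J ⊆ I →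
        coefSup s D a J ≤ c₀ * S.gk k ^ (1 : ℝ) → (I.card : ℝ) ≤ S.sites k →
        Eq324 (∫ z in smallFieldSet I (B10.pFun b₀ p₀ (S.gk k)), Real.exp (hamiltonian s D ϰ a J z) ∂P0 3 α β)
          (fun n => truncatedExp (P0 3 α β) (hamiltonian s D ϰ a J) n) 𝔠.nbar (𝔠.Ca + 𝔠.Cc) ((L : ℝ) ^ k * S.g0sq) (3 + 𝔠.κ₀)
          (S.sites k) :=
  eq324RowShape_benfatto_model_gk 𝔠 hα hβ hvar D hϰ hb₀ hp₀ one_pos hc₀ (by linarith)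

end Coupling

/-! ## §5 (v1.2) … with a VOLUME FACTOR: [2]'s `|I|` counts the cut-off variables (at B10's step ≈ the fluctuation variables, a bounded multiple `v·|T₁^{(k)}|` of the
site count — bond components × `dim 𝔤`), so the plug reads `|I| ≤ v·|T₁^{(k)}|` and `C·v ≤ Ca + Cc` -/

section Volume

open Summit.QuantumFields.Balaban3D.Proofs.ScalesArithmetic (gk_pos)

variable {N : ℕ} (𝔠 : AlphaConsts L N) {α β : ℝ}

/-- Budget comparison with a volume factor: `C·η^κ·|I| ≤ C′·η^κ·V` when `|I| ≤ v·V`, `C·v ≤ C′`, `C, V ≥ 0`, `η > 0`. [cite: Balaban1985UV3, (58) p.270 (bookkeeping)] -/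
theorem budget_le_vol {C C' η κ I v V : ℝ} (hC : 0 ≤ C) (hη : 0 < η) (hV : 0 ≤ V) (hIv : I ≤ v * V) (hCv : C * v ≤ C') :
    C * η ^ κ * I ≤ C' * η ^ κ * V := by
  have hηκ : 0 ≤ η ^ κ := Real.rpow_nonneg hη.le κ
  calc C * η ^ κ * I ≤ C * η ^ κ * (v * V) := mul_le_mul_of_nonneg_left hIv (mul_nonneg hC hηκ)
    _ = (C * v) * η ^ κ * V := by ring
    _ ≤ C' * η ^ κ * V := mul_le_mul_of_nonneg_right (mul_le_mul_of_nonneg_right hCv hηκ) hV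

/-- ★ **THE ROW'S SHAPE AT [2]'s MODEL IN [B10]'s CURRENCIES WITH A VOLUME FACTOR** — `eq324RowShape_benfatto_model_gk` with the region count bounded by `v·|T₁^{(k)}|` and the
record dominating `C·v`: for `g_k ≤ η₀`, `C·v ≤ Ca + Cc`, `|I| ≤ v·S.sites k`:
`Eq324 (∫ z in smallFieldSet I (p(g_k)), e^{H_J z} ∂P̂₀) (n ↦ ℰ̂₀ᵀ(H_J; n)) 𝔠.nbar (𝔠.Ca + 𝔠.Cc) (Lᵏ·S.g0sq) (3 + 𝔠.κ₀) (S.sites k)`.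
[cite: Balaban1985UV3, (41) p.266 + (56)–(58) p.270; Balaban1982Higgs1, (3.24) p.616; BenfattoEtAl1978, Lemma p.152] -/
theorem eq324RowShape_benfatto_model_gk_vol (hα : 0 < α) (hβ : 0 < β) (hvar : freeCov 3 α β 0 0 ≤ 1 / 2)
    (D : ℕ) {ϰ : ℝ} (hϰ : 0 < ϰ) {b₀ p₀ σ c₀ : ℝ} (hb₀ : 0 < b₀) (hp₀ : 2 / 3 < p₀) (hσ : 0 < σ) (hc₀ : 0 ≤ c₀)
    (hκσ : 6 + 2 * 𝔠.κ₀ < σ * (𝔠.nbar + 1)) :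
    ∃ η₀ C : ℝ, 0 < η₀ ∧ η₀ ≤ 1 ∧ 0 ≤ C ∧ ∀ (S : Scales L) (k : ℕ) (v : ℝ), S.gk k ≤ η₀ → C * v ≤ 𝔠.Ca + 𝔠.Cc →
      ∀ (s : ℕ) (I J : Finset (Fin 3 → ℤ)) (a : Coef 3), I.Nonempty → J ⊆ I →
        coefSup s D a J ≤ c₀ * S.gk k ^ σ → (I.card : ℝ) ≤ v * S.sites k →
        Eq324 (∫ z in smallFieldSet I (B10.pFun b₀ p₀ (S.gk k)), Real.exp (hamiltonian s D ϰ a J z) ∂P0 3 α β)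
          (fun n => truncatedExp (P0 3 α β) (hamiltonian s D ϰ a J) n) 𝔠.nbar (𝔠.Ca + 𝔠.Cc) ((L : ℝ) ^ k * S.g0sq) (3 + 𝔠.κ₀)
          (S.sites k) := by
  obtain ⟨η₀, C, hη₀, hη₀1, hC, h⟩ := eq324_benfatto_model (d := 3) (by norm_num) hα hβ hvar 𝔠.nbar D hϰ hb₀ hp₀ hσ hc₀
    (κ := 6 + 2 * 𝔠.κ₀) (by linarith [𝔠.κ₀_pos]) hκσ
  refine ⟨η₀, C, hη₀, hη₀1, hC, fun S k v hgk hCv s I J a hI hJI hA hI' => ?_⟩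
  have hg : 0 < S.gk k := gk_pos S k
  have h' := h _ hg hgk s I J a hI hJI hA
  rw [integral_cutoffBoltzmann_eq_setIntegral] at h'
  refine eq324_mono h' ?_
  rw [gk_rpow_six_add]
  exact budget_le_vol hC (mul_pos (pow_pos (L_pos S) k) (g0sq_pos S)) (sites_nonneg S k) hI' hCv

end Volume

end Summit.QuantumFields.YangMills.Theorems.BalabanUVNodesN08AlphaEq324RowCumLetterModel

end
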